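import Literature.Combinatorics.SimpleGraph.ListTreeDecomposition
import Mathlib.Data.List.Nodup
import Mathlib.Data.Finset.Card
import Mathlib.Data.Fintype.Basic
import HarnessLib

/-!
# Route MonotoneRestoration — crux `OrbitRestorationQP` (stmt-ValiantsHypothesis-18293), sub-crux K2 `HomPolyClose`
# Step 1: labelling the vertices of a rooted tree decomposition with `width + 1` labels, injectively on every bag

Helper toward the archived stub `stub_homPoly_close` of line `narrow-expansion` (a bipartite pattern of
treewidth `≤ w` is the closed polynomial of a labelled pattern expression with `w + 1` row and `w + 1`
column labels): the labels of the expression are read off a bag-injective labelling of a rooted tree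
decomposition in the list form of `Literature/Combinatorics/SimpleGraph/ListTreeDecomposition.lean`
(`ListTD.IsRootedTDOn`). The folklore fact behind every "dynamic programming
with `k + 1` registers over a tree decomposition of width `k`" (Arnborg–Proskurowski; Bodlaender's
`k`-terminal graphs; Lovász's `k`-labelled quantum graphs, *Large networks and graph limits*, §6; the
symmetric-circuit construction of Dawar–Pago–Seppelt, arXiv:2502.06740, §5, proof of Thm 5.3): the
vertices of a graph with a tree decomposition all of whose bags have at most `w + 1` vertices can be
labelled by `{0, …, w}` so that no bag carries a repeated label (equivalently: the chordal completion of a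
width-`w` decomposition is `(w+1)`-colourable — greedily along the rooted order).

* `updList_eq_or_mem`, `updList_mem_of_mem`, `updList_ne_of_nodup` — bookkeeping for the positional
  override `ListTD.updList` of `ListTreeDecomposition.lean`;
* **`exists_bag_labelling`**: for a rooted decomposition (list form) with bags of length `≤ w + 1` there
  is `lab : ℕ → ℕ` with `lab v ≤ w` for all `v` and `lab` injective on every bag.

The proof is the greedy colouring along the root order: bags `0, 1, 2, …` in turn; at bag `t` the vertices
already labelled are (by the rooted form of (T3)) exactly those of the parent bag, where the labels are
distinct, and the new vertices of bag `t` receive unused labels, of which there are enough.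

## References

* L. Lovász, *Large networks and graph limits*, AMS 2012, §6.5 (k-labelled graphs and tree-width).
* A. Dawar, B. Pago, T. Seppelt, *Symmetric algebraic circuits and homomorphism polynomials*,
  arXiv:2502.06740 (2025), §5 (proof of Thm 5.3).
* M. Cygan et al., *Parameterized Algorithms*, Springer 2015, §7.2–7.3 (dynamic programming over rooted
  tree decompositions).
-/

-- `Summit.ValiantsHypothesis.ValiantsHypothesis.…` is the tree's single-conjunct layout (Sub = Summit).
set_option linter.dupNamespace false

namespace Summit.ValiantsHypothesis.ValiantsHypothesis.Theorems.OrbitRestorationQPHomPolyClose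

open Literature.Combinatorics.SimpleGraph.ListTD

/-! ### The positional override `updList`: values -/

/-- An overridden map takes, at every point, either the old value or one of the overriding values.
[folklore] -/
theorem updList_eq_or_mem (a : ℕ → ℕ) : ∀ (P pv : List ℕ) (v : ℕ),
    updList a P pv v = a v ∨ updList a P pv v ∈ pv
  | [], pv, v => by cases pv <;> exact Or.inl rfl
  | _ :: _, [], v => Or.inl rfl
  | u :: P, x :: pv, v => by
    rw [updList]
    by_cases h : v = u
    · subst h
      exact Or.inr (by simp)
    · rw [Function.update_of_ne h]
      rcases updList_eq_or_mem a P pv v with h' | h'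
      · exact Or.inl h'
      · exact Or.inr (List.mem_cons_of_mem x h')

/-- On the overridden variables (with enough values) the overridden map takes overriding values.
[folklore] -/
theorem updList_mem_of_mem (a : ℕ → ℕ) : ∀ {P pv : List ℕ} {v : ℕ},
    v ∈ P → P.length ≤ pv.length → updList a P pv v ∈ pv
  | [], _, _, hv, _ => absurd hv List.not_mem_nil
  | _ :: _, [], _, _, hlen => by simp at hlen
  | u :: P, x :: pv, v, hv, hlen => by
    rw [updList]
    by_cases h : v = u
    · subst h
      simp
    · rw [Function.update_of_ne h]
      exact List.mem_cons_of_mem x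
        (updList_mem_of_mem a ((List.mem_cons.1 hv).resolve_left h) (by simpa using hlen))

/-- Overriding distinct variables by distinct values is injective on the overridden variables.
[folklore] -/
theorem updList_ne_of_nodup (a : ℕ → ℕ) : ∀ {P pv : List ℕ} {u v : ℕ},
    P.Nodup → pv.Nodup → P.length ≤ pv.length → u ∈ P → v ∈ P → u ≠ v →
      updList a P pv u ≠ updList a P pv v
  | [], _, _, _, _, _, _, hu, _, _ => absurd hu List.not_mem_nil
  | _ :: _, [], _, _, _, _, hlen, _, _, _ => by simp at hlen
  | z :: P, x :: pv, u, v, hP, hpv, hlen, hu, hv, huv => by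
    have hzP : z ∉ P := (List.nodup_cons.1 hP).1
    have hP' : P.Nodup := (List.nodup_cons.1 hP).2
    have hxpv : x ∉ pv := (List.nodup_cons.1 hpv).1
    have hpv' : pv.Nodup := (List.nodup_cons.1 hpv).2
    have hlen' : P.length ≤ pv.length := by simpa using hlen
    rw [updList]
    by_cases hu' : u = z
    · subst hu'
      have hv' : v ≠ u := Ne.symm huv
      have hvP : v ∈ P := (List.mem_cons.1 hv).resolve_left hv'
      rw [Function.update_self, Function.update_of_ne hv']
      intro h
      exact hxpv (h ▸ updList_mem_of_mem a hvP hlen')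
    · by_cases hv' : v = z
      · subst hv'
        have huP : u ∈ P := (List.mem_cons.1 hu).resolve_left hu'
        rw [Function.update_self, Function.update_of_ne hu']
        intro h
        exact hxpv (h ▸ updList_mem_of_mem a huP hlen')
      · rw [Function.update_of_ne hu', Function.update_of_ne hv']
        exact updList_ne_of_nodup a hP' hpv' hlen' ((List.mem_cons.1 hu).resolve_left hu')
          ((List.mem_cons.1 hv).resolve_left hv') huv

/-! ### The labelling -/

/-- **Bag-injective labelling with `w + 1` labels** (the greedy colouring of a rooted tree
decomposition): if every bag of a rooted tree decomposition (list form) has at most `w + 1` vertices,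
the vertices can be labelled by `{0, …, w}` injectively on every bag.
(Greedy colouring along the root order; Lovász 2012 §6.5, Dawar–Pago–Seppelt 2025 §5 use it silently.)
[folklore] -/
theorem exists_bag_labelling {S : Finset ℕ} {par : List ℕ} {bags : List (List ℕ)}
    (hD : IsRootedTDOn S par bags) {w : ℕ}
    (hw : ∀ t, t < bags.length → (bagOf bags t).length ≤ w + 1) :
    ∃ lab : ℕ → ℕ, (∀ v, lab v ≤ w) ∧ ∀ t, (bagOf bags t).Pairwise fun u v => lab u ≠ lab v := by
  classical
  -- greedy along the root order: after `m` steps the bags `< m` are injectively labelled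
  suffices h : ∀ m : ℕ, ∃ lab : ℕ → ℕ, (∀ v, lab v ≤ w) ∧
      ∀ t, t < m → (bagOf bags t).Pairwise fun u v => lab u ≠ lab v by
    obtain ⟨lab, hlab, hinj⟩ := h bags.length
    refine ⟨lab, hlab, fun t => ?_⟩
    by_cases ht : t < bags.length
    · exact hinj t ht
    · rw [bagOf_eq_nil (not_lt.1 ht)]
      exact List.Pairwise.nil
  intro m
  induction m with
  | zero => exact ⟨fun _ => 0, fun _ => Nat.zero_le _, fun t ht => absurd ht (Nat.not_lt_zero _)⟩
  | succ m ih =>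
    obtain ⟨lab, hlab, hinj⟩ := ih
    by_cases hm : bags.length ≤ m
    · -- no bag `m`: nothing to do
      refine ⟨lab, hlab, fun t ht => ?_⟩
      rcases Nat.lt_succ_iff_lt_or_eq.1 ht with h | rfl
      · exact hinj t h
      · rw [bagOf_eq_nil hm]
        exact List.Pairwise.nil
    rw [not_le] at hm
    -- the old vertices `K` (those of the parent bag, when `m ≠ 0`) and the new ones `P` of bag `m`
    set B := bagOf bags m with hB
    set p := parOf par m with hp
    set old : ℕ → Bool := fun v => decide (m ≠ 0 ∧ v ∈ bagOf bags p) with hold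
    set K := B.filter old with hK
    set P := B.filter (! old ·) with hP
    have hBnd : B.Nodup := hD.bag_nodup m
    have hPnd : P.Nodup := hBnd.filter _
    have hKP : B.length = K.length + P.length := List.length_eq_length_filter_add old
    -- the free labels
    set Free : Finset ℕ := Finset.range (w + 1) \ (K.map lab).toFinset with hFree
    set fl := Free.toList with hfl
    have hflnd : fl.Nodup := Finset.nodup_toList Free
    have hfl_mem : ∀ x, x ∈ fl ↔ x < w + 1 ∧ x ∉ K.map lab := fun x => by
      rw [hfl, Finset.mem_toList, hFree, Finset.mem_sdiff, Finset.mem_range, List.mem_toFinset]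
    have hcard : P.length ≤ fl.length := by
      rw [hfl, Finset.length_toList]
      have h1 : Free.card + (Finset.range (w + 1) ∩ (K.map lab).toFinset).card = w + 1 := by
        rw [hFree, Finset.card_sdiff_add_card_inter, Finset.card_range]
      have h2 : (Finset.range (w + 1) ∩ (K.map lab).toFinset).card ≤ K.length :=
        (Finset.card_le_card Finset.inter_subset_right).trans
          ((List.toFinset_card_le _).trans (List.length_map _).le)
      have h3 : B.length ≤ w + 1 := hw m hm
      omega
    -- the new labelling
    refine ⟨updList lab P fl, fun v => ?_, fun t ht => ?_⟩
    · rcases updList_eq_or_mem lab P fl v with h | h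
      · rw [h]; exact hlab v
      · exact Nat.lt_succ_iff.1 ((hfl_mem _).1 h).1
    -- vertices of `P` lie in no earlier bag, and `K` lies in the parent bag, an earlier one
    have hPnew : ∀ v ∈ P, ∀ s, s < m → v ∉ bagOf bags s := by
      intro v hv s hs hvs
      obtain ⟨hvB, hvold⟩ := List.mem_filter.1 hv
      have hm0 : m ≠ 0 := by omega
      have hvp : v ∈ bagOf bags p := hD.rooted v s m hs hm hvB hvs
      simp [hold, hm0, hvp] at hvold
    have hKold : ∀ v ∈ B, v ∉ P → m ≠ 0 ∧ v ∈ bagOf bags p := by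
      intro v hvB hvP
      by_contra h
      exact hvP (List.mem_filter.2 ⟨hvB, by rw [Bool.not_eq_true', hold]; exact decide_eq_false h⟩)
    rcases Nat.lt_succ_iff_lt_or_eq.1 ht with hlt | heq
    · -- an earlier bag keeps its labels
      refine (hinj t hlt).imp_of_mem fun {u} {v} hu hv h => ?_
      rwa [updList_of_not_mem lab fl fun huP => hPnew u huP t hlt hu,
        updList_of_not_mem lab fl fun hvP => hPnew v hvP t hlt hv]
    · -- the bag `m` itself
      rw [heq, ← hB]
      refine hBnd.imp_of_mem fun {u} {v} hu hv huv => ?_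
      by_cases huP : u ∈ P <;> by_cases hvP : v ∈ P
      · exact updList_ne_of_nodup lab hPnd hflnd hcard huP hvP huv
      · obtain ⟨-, hvp⟩ := hKold v hv hvP
        rw [updList_of_not_mem lab fl hvP]
        have hvK : v ∈ K := List.mem_filter.2 ⟨hv, by simpa [hold] using hKold v hv hvP⟩
        intro h
        have hmem := updList_mem_of_mem lab huP hcard
        rw [h] at hmem
        exact ((hfl_mem _).1 hmem).2 (List.mem_map.2 ⟨v, hvK, rfl⟩)
      · obtain ⟨-, hup⟩ := hKold u hu huP
        rw [updList_of_not_mem lab fl huP]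
        have huK : u ∈ K := List.mem_filter.2 ⟨hu, by simpa [hold] using hKold u hu huP⟩
        intro h
        have hmem := updList_mem_of_mem lab hvP hcard
        rw [← h] at hmem
        exact ((hfl_mem _).1 hmem).2 (List.mem_map.2 ⟨u, huK, rfl⟩)
      · obtain ⟨hm0, hup⟩ := hKold u hu huP
        obtain ⟨-, hvp⟩ := hKold v hv hvP
        rw [updList_of_not_mem lab fl huP, updList_of_not_mem lab fl hvP]
        have hplt : p < m := hD.par_lt m (Nat.pos_of_ne_zero hm0) hm
        have hsymm : Std.Symm (fun u v : ℕ => lab u ≠ lab v) := ⟨fun _ _ h => Ne.symm h⟩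
        exact (hinj p hplt).forall hup hvp huv

end Summit.ValiantsHypothesis.ValiantsHypothesis.Theorems.OrbitRestorationQPHomPolyClose
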